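import Summits.BirchSwinnertonDyer.Rank1Residual.GaloisImage.KummerConditionUnramifiedTamagawaFree
import Summits.BirchSwinnertonDyer.Rank1Residual.X10.SelmerCompanionsTamagawaFree
import HarnessLib

/-!
# The RESIDUAL Selmer group `S⁰(E) ⊆ H¹(K, E[p])` of the N2 lane, defined in the tree's
# Galois-cohomology currency, and `S⁰(E) = Sel_p(E)` for a Tamagawa-`p`-free curve
# (cell `b2b-bsdres`, unit `b2b-bsdres-x10` = N2 class lead, GEN 31; two definitions with bodies +
# theorems; no named fact; nothing booked — glue G9 of `HOME/class-closure/N2/P-INSTANCE-ASK-x10g31.md`)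

HONEST FRAMING (run/shared/lean/b2b/bsd-rank1-residual/, verbatim in every file): the goal of the
cell is to DELETE the COMBINATION-SHAPED residual classes of the Birch–Swinnerton-Dyer formula for
ALL analytic-rank `≤ 1` elliptic curves over `ℚ` — "full BSD formula for every rank `≤ 1` curve in
class `C`" assembled STRICTLY from published theorems — so that the rank-`≤ 1` remainder becomes
exactly the CONSTRUCTION-SHAPED classes, which are TYPED (missing-input `Prop`s), NOT attempted.
This is not "finishing BSD". Class X10b (= N2) keeps its label CONSTRUCTION-SHAPED (NEEDS `X_A3`,
referee R82.3 / RESIDUAL-MAP §I N2); this file is a TOOL; no mark / label / tier / count moves.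

## What

The N2 memo (`HOME/class-closure/N2/TRIVIAL-ROADS-x10g27.md` §1) decides every N2 cell through ONE
subgroup of `H¹(ℚ, E[3])`, Mazur–Rubin 2007's residual structure `𝓖` of the Kummer structure `𝓕`:
`S⁰(E) := {ξ ∈ H¹(ℚ, E[3]) : ξ_ℓ ∈ H¹_ur(ℚ_ℓ, E[3]) ∀ ℓ ≠ 3, ξ₃ ∈ 𝓛₃(E)}` ("`H¹_𝓖(K_v) = H¹_ur` for
`v ∤ p`, `= H¹_𝓕(K_v)` for `v ∣ p`"). So far the kernel had it only abstractly (x10 GEN 30–31: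
`X10/ResidualSelmerParity.residual`, `X10/ResidualSelmerParityGroupForm` by membership). This file
DEFINES it on the tree's objects — the Kummer Selmer structure `W.kummerSelmerStructure p`
(`Literature/NumberTheory/EllipticCurves/KummerSelmerStructure.lean`) and the unramified subgroups
`DiscreteGaloisModule.unramifiedSubgroup` — for an elliptic curve over any number field `K` and any
prime `p`:

* `residualSelmerStructure W p : SelmerStructure (W.torsionGaloisModule p)` — the Kummer condition at the
  places above `p` and at the archimedean places (where it is all of `H¹` for odd `p`), the unramified
  subgroup at every other finite place; `residualSelmerGroup W p := its Selmer group = S⁰(E)`;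
  unfolding and membership lemmas (`mem_residualSelmerGroup_iff`) — the `hS0` binder of
  `ResidualSelmerParityGroupForm.even_add_add_card_groupForm` with `P = {v ∣ p} ∪ {v ∣ ∞}`.
* **`residualSelmerStructure_eq_kummerSelmerStructure_of_forall_not_dvd`** /
  **`residualSelmerGroup_eq_selmerGroup_of_not_dvd_tamagawaProduct`** — if `p ∤ c_v(E)` at every finite
  `v ∤ p` (in particular if `p ∤ Tam(E)`), the residual structure IS the Kummer structure and
  `S⁰(E) = Sel_p(E)` as subgroups of `H¹(K, E[p])`: the TRIVIAL-ROADS law (X) for `A = E` at the level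
  of GROUPS, fact-free, from team n1011's LOCAL equality `𝓛_v(E[p]) = H¹_ur(K_v, E[p])` at
  Tamagawa-`p`-free `v ∤ p` (`kummerSelmerStructure_inr_eq_unramifiedSubgroup_of_not_dvd_localTamagawaNumber_prime`,
  row T-URTAM, Milne *ADT* I Prop. 3.8 / Schaefer–Stoll 2004 Lemma 3.1) and the tree's
  `selmerGroup_eq_selmerGroup_kummerSelmerStructure`. For a UNIT cell (`Sel₃(E) = 0`, `T_E = ∅`) this
  reads `S⁰(E) = 0`; for a Ш-cell with `T_E = ∅` it reads `S⁰(E) = Sel₃(E) ≠ 0` (memo §3, NOGO-sha).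

## References

* [MazurRubin2007] B. Mazur, K. Rubin, *Finding large Selmer rank via an arithmetic theory of local
  constants*, Ann. of Math. 166 (2007), Def. 1.2, Thm. 1.4 (the structures `𝓕`, `𝓖`).
* [MazurRubin2004] B. Mazur, K. Rubin, *Kolyvagin systems*, Mem. AMS 799 (2004), Def. 2.1.1.
* [MilneADT2006] J. S. Milne, *Arithmetic Duality Theorems*, I Prop. 3.8, Rem. 3.10.
* [SchaeferStoll2004] E. Schaefer, M. Stoll, Trans. AMS 356 (2004), §3 Lemma 3.1, Prop. 3.2.
* HOME/class-closure/N2/{TRIVIAL-ROADS-x10g27.md §1, P-INSTANCE-ASK-x10g31.md}; HOME/X10-AUDIT.md §37.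
-/

set_option autoImplicit false

noncomputable section

open scoped Classical

open WeierstrassCurve Literature.NumberTheory.EllipticCurves Literature.NumberTheory.GaloisRepresentations
  NumberField IsDedekindDomain
open Literature.NumberTheory.GaloisRepresentations.DiscreteGaloisModule (unramifiedSubgroup SelmerStructure)
open Summit.BirchSwinnertonDyer.Rank1Residual.GaloisImage.InertiaDivisible
open Summit.BirchSwinnertonDyer.Rank1Residual.X10.SelmerCompanionsTamagawaFree

namespace Summit.BirchSwinnertonDyer.Rank1Residual.X10.ResidualSelmerGroup

variable {K : Type} [Field K] [NumberField K] (W : WeierstrassCurve K) (p : ℕ)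

/-! ### §1. The residual Selmer structure and `S⁰(E)` -/

/-- **The residual Selmer structure `𝓖` of `E[p]`** (Mazur–Rubin 2007, the structure with
`H¹_𝓖(K_v) = H¹_ur(K_v, E[p])` for finite `v ∤ p` and `H¹_𝓖(K_v) = H¹_𝓕(K_v)` = the Kummer condition
for `v ∣ p`; at the archimedean places the Kummer condition, which for odd `p` is all of
`H¹(K_v, E[p]) = 0`), as a `SelmerStructure` on the tree's `W.torsionGaloisModule p`.
[cite: MazurRubin2007, Def. 1.2 and Thm. 1.4] [cite: MazurRubin2004, Def. 2.1.1] -/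
def residualSelmerStructure : SelmerStructure (W.torsionGaloisModule (p : ℤ)) := fun v =>
  match v with
  | Sum.inl w => W.kummerSelmerStructure (p : ℤ) (Sum.inl w)
  | Sum.inr v =>
    if (p : 𝓞 K) ∈ v.asIdeal then W.kummerSelmerStructure (p : ℤ) (Sum.inr v)
    else unramifiedSubgroup (GaloisRep.toLocal v (W.torsionGaloisModule (p : ℤ))) 1

/-- **The residual Selmer group `S⁰(E) = H¹_𝓖(K, E[p]) ⊆ H¹(K, E[p])`**: the classes satisfying the
Kummer condition above `p` (and at `∞`) and UNRAMIFIED at every other finite place — the group of the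
N2 memo (all Tamagawa-`3`-free good-at-`3` curves `3`-congruent to `E` have `3`-Selmer group `S⁰(E)`).
[cite: MazurRubin2007, Def. 1.2 and Thm. 1.4] -/
def residualSelmerGroup : AddSubgroup (galH1Torsion W (p : ℤ)) :=
  (residualSelmerStructure W p).selmerGroup

/-- At an archimedean place the residual condition is the Kummer condition. [cite: MazurRubin2007, Def. 1.2] -/
@[simp] theorem residualSelmerStructure_inl (w : InfinitePlace K) :
    residualSelmerStructure W p (Sum.inl w) = W.kummerSelmerStructure (p : ℤ) (Sum.inl w) := rfl

/-- Above `p` the residual condition is the Kummer condition. [cite: MazurRubin2007, Def. 1.2] -/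
theorem residualSelmerStructure_inr_of_mem {v : HeightOneSpectrum (𝓞 K)} (hv : (p : 𝓞 K) ∈ v.asIdeal) :
    residualSelmerStructure W p (Sum.inr v) = W.kummerSelmerStructure (p : ℤ) (Sum.inr v) := by
  simp only [residualSelmerStructure, if_pos hv]

/-- At a finite place `v ∤ p` the residual condition is the unramified subgroup.
[cite: MazurRubin2007, Def. 1.2] -/
theorem residualSelmerStructure_inr_of_not_mem {v : HeightOneSpectrum (𝓞 K)}
    (hv : (p : 𝓞 K) ∉ v.asIdeal) :
    residualSelmerStructure W p (Sum.inr v) =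
      unramifiedSubgroup (GaloisRep.toLocal v (W.torsionGaloisModule (p : ℤ))) 1 := by
  simp only [residualSelmerStructure, if_neg hv]

/-- **Membership in `S⁰(E)`**: `ξ ∈ S⁰(E)` iff `ξ_v` satisfies the Kummer condition at every
archimedean place and every `v ∣ p`, and the residual condition (= the unramified subgroup,
`residualSelmerStructure_inr_of_not_mem`) at every finite `v ∤ p` — the N2 memo's
`S⁰(E) = {ξ : ξ_ℓ ∈ H¹_ur ∀ ℓ ≠ 3, ξ₃ ∈ 𝓛₃(E)}`. [cite: MazurRubin2007, Def. 1.2] -/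
theorem mem_residualSelmerGroup_iff (c : galH1Torsion W (p : ℤ)) :
    c ∈ residualSelmerGroup W p ↔
      (∀ w : InfinitePlace K, galoisCohomology.localization (W.torsionGaloisModule (p : ℤ)) (Sum.inl w) 1 c ∈
          W.kummerSelmerStructure (p : ℤ) (Sum.inl w)) ∧
        (∀ v : HeightOneSpectrum (𝓞 K), (p : 𝓞 K) ∈ v.asIdeal →
          galoisCohomology.localization (W.torsionGaloisModule (p : ℤ)) (Sum.inr v) 1 c ∈
            W.kummerSelmerStructure (p : ℤ) (Sum.inr v)) ∧
        ∀ v : HeightOneSpectrum (𝓞 K), (p : 𝓞 K) ∉ v.asIdeal →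
          galoisCohomology.localization (W.torsionGaloisModule (p : ℤ)) (Sum.inr v) 1 c ∈
            residualSelmerStructure W p (Sum.inr v) := by
  -- `residualSelmerGroup` is the structure's Selmer group seen in `H¹(K, E[p]) = galH1Torsion W p`
  -- (the same group as `galoisCohomology (W.torsionGaloisModule p) 1`, cf. the tree's
  -- `selmerGroup_eq_selmerGroup_kummerSelmerStructure`)
  refine (((residualSelmerStructure W p).mem_selmerGroup_iff c :
    c ∈ (residualSelmerStructure W p).selmerGroup ↔ _)).trans ?_
  rw [Sum.forall]
  refine and_congr Iff.rfl ⟨fun h => ⟨fun v hv => ?_, fun v _ => h v⟩, fun h v => ?_⟩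
  · rw [← residualSelmerStructure_inr_of_mem W p hv]; exact h v
  · by_cases hv : (p : 𝓞 K) ∈ v.asIdeal
    · rw [residualSelmerStructure_inr_of_mem W p hv]; exact h.1 v hv
    · exact h.2 v hv

/-- The residual and the Kummer structures AGREE at the archimedean places and above `p` (by
definition). [cite: MazurRubin2007, Def. 1.2] -/
theorem residualSelmerStructure_eq_kummerSelmerStructure_of_mem {v : HeightOneSpectrum (𝓞 K)}
    (hv : (p : 𝓞 K) ∈ v.asIdeal) :
    residualSelmerStructure W p (Sum.inr v) = W.kummerSelmerStructure (p : ℤ) (Sum.inr v) :=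
  residualSelmerStructure_inr_of_mem W p hv

/-! ### §2. (X) for `A = E`: a Tamagawa-`p`-free curve has `S⁰(E) = Sel_p(E)` -/

variable [W.IsElliptic] [Fact p.Prime]

/-- **At a finite `v ∤ p` with `p ∤ c_v(E)` the residual condition IS the Kummer condition** — team
n1011's LOCAL equality `𝓛_v(E[p]) = H¹_ur(K_v, E[p])` (row T-URTAM, any reduction type; Milne *ADT* I
Prop. 3.8 with Rem. 3.10; Schaefer–Stoll 2004 Lemma 3.1). [cite: MilneADT2006, Ch. I Prop. 3.8 and Remark 3.10]
[cite: SchaeferStoll2004, §3 Lemma 3.1 and Prop. 3.2] -/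
theorem residualSelmerStructure_eq_kummerSelmerStructure_of_not_dvd {v : HeightOneSpectrum (𝓞 K)}
    (hv : (p : 𝓞 K) ∉ v.asIdeal)
    (hc : ¬ p ∣ (W.baseChange (v.adicCompletion K)).localTamagawaNumber (v.adicCompletionIntegers K)) :
    residualSelmerStructure W p (Sum.inr v) = W.kummerSelmerStructure (p : ℤ) (Sum.inr v) := by
  rw [residualSelmerStructure_inr_of_not_mem W p hv,
    kummerSelmerStructure_inr_eq_unramifiedSubgroup_of_not_dvd_localTamagawaNumber_prime W p hv hc]

/-- **A curve with `p ∤ c_v` at every finite `v ∤ p` has residual structure = Kummer structure.**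
[cite: MilneADT2006, Ch. I Prop. 3.8 and Remark 3.10] [cite: MazurRubin2007, Def. 1.2] -/
theorem residualSelmerStructure_eq_kummerSelmerStructure_of_forall_not_dvd
    (hc : ∀ v : HeightOneSpectrum (𝓞 K), (p : 𝓞 K) ∉ v.asIdeal →
      ¬ p ∣ (W.baseChange (v.adicCompletion K)).localTamagawaNumber (v.adicCompletionIntegers K)) :
    residualSelmerStructure W p = W.kummerSelmerStructure (p : ℤ) := by
  funext v
  rcases v with w | v
  · rfl
  · by_cases hv : (p : 𝓞 K) ∈ v.asIdeal
    · exact residualSelmerStructure_inr_of_mem W p hv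
    · exact residualSelmerStructure_eq_kummerSelmerStructure_of_not_dvd W p hv (hc v hv)

/-- **(X) for `A = E` — a Tamagawa-`p`-free curve has `S⁰(E) = Sel_p(E)`** as subgroups of
`H¹(K, E[p])` (`Sel_p` = the tree's `W.selmerGroup p`, identified with the Kummer structure's Selmer
group by `selmerGroup_eq_selmerGroup_kummerSelmerStructure`): if `p ∤ c_v(E)` at every finite `v ∤ p`
then the residual and Kummer structures coincide. THE N2 READING (memo §3): a UNIT cell
(`Sel₃(E) = 0`, `T_E = ∅`) has `S⁰(E) = 0`; a Ш-cell with `T_E = ∅` has `S⁰(E) = Sel₃(E) ≠ 0`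
(NOGO-sha). Fact-free. [cite: MazurRubin2007, Def. 1.2 and Thm. 1.4] [cite: MilneADT2006, Ch. I Prop. 3.8 and Remark 3.10] -/
theorem residualSelmerGroup_eq_selmerGroup_of_forall_not_dvd
    (hc : ∀ v : HeightOneSpectrum (𝓞 K), (p : 𝓞 K) ∉ v.asIdeal →
      ¬ p ∣ (W.baseChange (v.adicCompletion K)).localTamagawaNumber (v.adicCompletionIntegers K)) :
    residualSelmerGroup W p = W.selmerGroup (p : ℤ) := by
  rw [residualSelmerGroup, residualSelmerStructure_eq_kummerSelmerStructure_of_forall_not_dvd W p hc,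
    selmerGroup_eq_selmerGroup_kummerSelmerStructure]

/-- **`p ∤ Tam(E) ⟹ S⁰(E) = Sel_p(E)`** (`c_v ∣ Tam(E)`, x10 GEN 29's
`not_dvd_localTamagawaNumber_of_not_dvd_tamagawaProduct`). THE INSTANCE for the records: the 77 UNIT
cells and the Ш-cells with `T_E = ∅` of N2 (Tamagawa numerals `UnitRoad.tamagawaProduct_u<E>`).
[cite: MazurRubin2007, Def. 1.2 and Thm. 1.4] [cite: SilvermanAEC2009, Cor. VII.6.2] -/
theorem residualSelmerGroup_eq_selmerGroup_of_not_dvd_tamagawaProduct (htam : ¬ p ∣ W.tamagawaProduct) :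
    residualSelmerGroup W p = W.selmerGroup (p : ℤ) :=
  residualSelmerGroup_eq_selmerGroup_of_forall_not_dvd W p fun v _ =>
    not_dvd_localTamagawaNumber_of_not_dvd_tamagawaProduct W htam v

/-- **Order form**: `p ∤ Tam(E)` and `#Sel_p(E) = n` ⟹ `#S⁰(E) = n` (so a certified `p`-descent value
is at once the order of the residual group — the input `hs₀` of the parity law in group currency).
[cite: MazurRubin2007, Thm. 1.4] -/
theorem natCard_residualSelmerGroup_eq_of_not_dvd_tamagawaProduct (htam : ¬ p ∣ W.tamagawaProduct)
    {n : ℕ} (hSel : Nat.card (W.selmerGroup (p : ℤ)) = n) : Nat.card (residualSelmerGroup W p) = n := by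
  rw [residualSelmerGroup_eq_selmerGroup_of_not_dvd_tamagawaProduct W p htam, hSel]

/-- **UNIT cells have `S⁰(E) = 0`**: `p ∤ Tam(E)` and `#Sel_p(E) = 1` ⟹ `S⁰(E) = ⊥` (memo §3, the
77 UNIT cells; (C2)'s converse direction). [cite: MazurRubin2007, Thm. 1.4] -/
theorem residualSelmerGroup_eq_bot_of_not_dvd_tamagawaProduct (htam : ¬ p ∣ W.tamagawaProduct)
    (hSel : Nat.card (W.selmerGroup (p : ℤ)) = 1) : residualSelmerGroup W p = ⊥ :=
  AddSubgroup.eq_bot_of_card_eq _ (natCard_residualSelmerGroup_eq_of_not_dvd_tamagawaProduct W p htam hSel)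

end Summit.BirchSwinnertonDyer.Rank1Residual.X10.ResidualSelmerGroup

end
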